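import Literature.MathematicalPhysics.QuantumFieldTheory.Balaban1983to89.B9Eq347LocalLetterAlgebra
import Literature.MathematicalPhysics.QuantumFieldTheory.Balaban1983to89.B9Eq347LocalFromBlockDecay
import Literature.MathematicalPhysics.QuantumFieldTheory.Balaban1983to89.B9Eq347GlobalFromLocal
import Literature.MathematicalPhysics.QuantumFieldTheory.Balaban1983to89.B9Eq349BlockDecayAlgebra

/-!
# `Balaban1983to89.B9Eq326G1SupRowOfLetters` — T. Bałaban, *Propagators for lattice gauge theories in a background field*, Commun. Math. Phys. **99**
# (1985) 389–434 [Balaban1985BackgroundPropagators] (3.25)–(3.27) pp. 394–395 (*«R = I − G′Q′*(Q′G′²Q′*)⁻¹Q′G′»*, *«Δ_a(U) = Δ(U) + D_UR(U)D*_U + Q*(U)aQ(U)»*,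
# `G = Δ_a⁻¹`), Thm 3.1 (3.42) p. 397 (the LOCAL inequalities for `G′(U)`), (3.49) p. 399 and Thm 3.3 p. 399 (*«the operator G(U) satisfies the
# inequalities (3.42)–(3.47), with G′(U) replaced by G(U)»*): **THE LOCAL SUP LETTER (L) OF THE BOND PROPAGATOR `G₁ = Δ_a⁻¹` FROM THE WOODBURY IDENTITY
# AROUND ITS LOCAL PART `A₀ = Δ(U) + D_UD*_U + Q†aQ` AND FOUR DISPLAYED LETTERS — `G₁ = A₀⁻¹ + A₀⁻¹∘Uu∘[c + c∘V∘G₁∘Uu∘c]∘V∘A₀⁻¹`, `Uu = D_UG′Q̃′†`,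
# `V = Q̃′G′D*_U = Uu†`, `c = (Q̃′G′²Q̃′†)⁻¹` (the tree's `B9Eq326WoodburySchur.G1ofU_eq_woodbury`): (L)(A₀⁻¹), (L)(Uu), (L)(c) and the `L²` bond-block decay of
# `G₁` ⟹ (L)(G₁; B⋆, κ′) with `B⋆` CLOSED-FORM and every currency price HEIGHT-FREE on the tower's diagonal** — the Woodbury assembly of the pub-balaban NE9
# owner's plan v11 (`t4/b2b-balaban-t4-ne9-p1/g91/PLAN-V11-STOREY-G1.md` §2) read at the tower for beta-an4's INTERFACE REQUEST D4 `exists_local_letter_G1k`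
# (journal `HOME/CLAIMS.log` l.64394), in ne9-leaf-03's (L)-letter algebra, ABSTRACT over the carriers (any finite index types over any block lattice `Y`
# with a pseudo-metric `δ`; §4 the coarse torus `T_m`)

statement-level skeleton of published theorems with citation tags; proofs where landed; nothing here is a claim about the Yang–Mills mass gap

CITATION HEADER (lean-in-tree rule).  Audit cell `pub-balaban`, sub-cell `t4`, BINDER row NE9; filed by NE9 crux-team LEAF PROVER 05
(`b2b-balaban-t4-ne9-formalise-leaf-05`, gen 87; the storey-J ∕ (K41)–(K60) lineage).  Composed BY NAME, nothing restated: ne9-leaf-03's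
`B9Eq347LocalLetterAlgebra.local_comp_one` (the composition of two (L) letters, one middle sum), `B9Eq347GlobalFromLocal.local_transport` (the `WL2` spelling),
`B9Eq347LocalFromBlockDecay.local_of_block_decay` (block decay ⟹ (L); on the unit lattice blocks = points, no price); ne9-leaf-01's `B9Eq349BlockDecayAlgebra.norm_block_comp3_le_of_decay`
(three block-decaying factors) and `B9Eq349BlockMultipliers.sum_block_apply` ∕ `block_comp_self` (the (K1) block family resolves the identity); `B4Sect5Torus.torusSum_le`
(the volume-free row constant `K_d`).  The identity `hW` is DISPLAYED in the shape of the NE9 owner's `B9Eq326WoodburySchur.G1ofU_eq_woodbury` (t4-ne9-p1 g91);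
its tower twin, and the four letters, are the suppliers' (docstring of `local_letter_G1_of_adjoint`).  Sources READ first-hand this generation in the held text
(`paper:balaban1985-cmp99-background-propagators`, journal page = PDF page + 388): p. 394 (3.25), p. 395 (3.26)–(3.27), p. 397 Thm 3.1 (3.42), p. 399 (3.49) and
Thm 3.3.  Print proves Thm 3.3 by the random walk of Sect. C with local gauge fixing (pp. 415–434); the cell's road is the Kato-type sup bootstrap for `A₀⁻¹`
(ne9-leaf-03's (EA0S)), storey J's gradient row for `D_UG′` (t4-ne9-p1's `B9Eq342GreenPrimeTowerGradientRow` on this lineage's (K41) engine), Combes–Thomas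
for the `L²` block decay of `G₁` (ne9-leaf-03's (FCLG)) — and THIS file's algebra; NOTHING of print's proof is reproduced and no constant of print is valued.

WHAT IS PROVED (sorry-free; proof lane — no `def`; [folklore] finite sums and operator algebra).  THE LETTER (L)(T; B, κ), always DISPLAYED and always
read through `WL2.equiv`: «for every block `v`, every source `f` supported over `π⁻¹(v)` with `‖f(x)‖ ≤ F`, every output point `x′`:
`‖(Tf)(x′)‖ ≤ B·e^{−κδ(π′x′, v)}·F`» (`B9Eq347GlobalFromLocal`'s `hloc`, `B9Eq347LocalLetterAdjoint`'s `hloc`).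
* §0 (any three weighted carriers over `Y`) **`letter_comp`** — (L)(T₁; B₁, κ₁), (L)(T₂; B₂, κ₂), `0 ≤ κ′ ≤ κ₁`, `Σ_u e^{−(κ₂−κ′)δ(w,u)} ≤ S` ⟹
  (L)(T₂∘T₁; B₁B₂S, κ′) (`local_comp_one` transported); **`letter_mono`**; **`letter_reblock`** (output block map changed at cost `e^{κr}` when
  `δ(π₂x,v) ≤ δ(π₂′x,v) + r` — the tip-block ∕ base-block junction of a gradient row); **`letter_add`**.
* §1 (fine bonds `X_B`, weights `w_B`, block map `π_B`; the unit lattice `Y`, weights `w_Y`, `π = id`; bond block family `P`, point family `r` by their (K1)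
  letters; `A₀⁻¹, G₁ : bonds → bonds`, `Uu : points → bonds`, `V : bonds → points`, `c : points → points` as continuous linear maps)
  **`core_point_decay`** — the entries of the core `X = V∘G₁∘Uu` from three block letters (`norm_block_comp3_le_of_decay` through `P`);
  **`core_letter_of_point_decay`** — (L)(X) from its entries (blocks = points; price `√μ_Y∕√ω_Y`);
  **`local_letter_G1_of_letters`** — THE ASSEMBLY: `hW`, (L)(A₀⁻¹; B_A, κ), (L)(Uu; B_U, κ), (L)(V∘A₀⁻¹; B_V, κ′), (L)(c; B_c, κ), the block letters of
  `G₁`, `Uu`, `V`, `0 ≤ κ′ < κ`, ONE row constant `S` at the gap `(κ−κ′)∕2` ⟹ **(L)(G₁; B_A + B_A·B_U·B_c·B_V·S³·(1 + B_c·B_X·S²), κ′)**,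
  `B_X = C_V·A₁·C_U·S²·√μ_Y∕√ω_Y` — the two words `A₀⁻¹∘Uu∘c∘(V∘A₀⁻¹)` and `A₀⁻¹∘Uu∘c∘X∘c∘(V∘A₀⁻¹)` composed with the OUTER factor always at the
  primitive rate `κ` (so the rate is lost ONCE, `κ ↦ κ′`), the core entering at the middle rate `(κ+κ′)∕2`;
  **`local_letter_G1_of_four_letters`** — the same with the Schur core `S⁻¹` DISPLAYED as ONE operator `Sc` with its own letter (the 4-letter interface of
  ne9-leaf-03 g78's (AWS) `B9Eq326WoodburySupRowAssembly.woodbury_sup_row`, on the weighted carriers): (L)(G₁; B_A + B_V·B_S·S₂·B_U·S₁·B_A·S₁, κ′).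
* THE SEQUEL `B9Eq326G1SupRowAdjoint` (same generation) derives the right factor `V∘A₀⁻¹ = (A₀⁻¹∘Uu)†` and the block letters of `Uu` ∕ `V` from the
  adjoint structure (prices `μ_B∕ω_Y`, `√μ_B∕√ω_Y` — `d`, `√d` on the tower's diagonal), reads (L)(Uu) from the covariant-gradient row of `D_UG′`, and
  discharges `S = K_d((κ−κ′)∕2)` over the coarse torus `T_m`.
WHY THE LEFT FACTOR NEEDS THE GRADIENT ROW AND THE RIGHT ONE DOES NOT (located remark R-leaf05-g87-1, journal l.64887): `A₀⁻¹∘Uu` is read at FINE bonds —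
its letter is (L)(A₀⁻¹) ∘ (L)(Uu), and (L)(Uu) needs `D_UG′` run DIRECTLY (storey J at the tower); `V∘A₀⁻¹ = (A₀⁻¹∘Uu)†` is read at COARSE points — `local_adjoint`
prices it by `d`; the core's entries need only `L²` block letters ((FCLG) for `G₁`, `block_decay_of_local` for `Uu`, its adjoint for `V`).  Hence NO `L²`
gradient letter and NO Combes–Thomas estimate on the Schur core `S = c⁻¹ − V∘A₀⁻¹∘Uu` enter: the bracket `c + c∘V∘G₁∘Uu∘c` IS `S⁻¹`, expanded.
HONEST SCOPE.  Algebra over DISPLAYED letters; the four letters, the identity at the tower (`G1k`, `GpOfUk`, `Q̃′_k`, `c_k`) and the adjoint facts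
(`(D*_U)† = D_U` given `hRS`, `G′† = G′`, `A₀⁻¹† = A₀⁻¹` — this lineage's `B9Eq326LocalPartGradientRowAdjoint`) are the suppliers' and the instantiator's;
`B⋆` is crude (no optimisation of the `S`-powers); nothing of [B9] Thm 3.1 ∕ 3.3 ∕ 3.11 is asserted, valued or discharged.  NOT NE9 (cell pub-balaban: NE9 NOT
PRINTED ∕ NOT PROVED; «NE9 ⇐ the named binders»; row WALLED ON A MODEL (O-NE9-1; #5 UNRULED); spine PROVED 0∕9; rung (B)+1 on a finite T⁴ — NOT infinite
volume, NOT mass gap, NOT BetaPertH, NOT Clay; HONEST DEPENDENCY: continuum YM on T⁴ ⇐ BetaPertH ∧ nine spine estimates (0/9 proved); BetaPertH ⇐ (D1) ∧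
(D4) ∧ CAP+tail; G-an2-4 gates asym, D1 and NE2/3/4).  NEW file importing four BUILT modules (ne9-leaf-03's `B9Eq347LocalLetterAlgebra` ∕ `B9Eq347LocalFromBlockDecay` ∕ `B9Eq347GlobalFromLocal`, ne9-leaf-01's
`B9Eq349BlockDecayAlgebra`); nothing modified.  Net new unproved
facts: 0.
-/

noncomputable section

set_option autoImplicit false

open scoped BigOperators InnerProductSpace

namespace Literature.MathematicalPhysics.QuantumFieldTheory.Balaban1983to89.B9Eq326G1SupRowOfLetters

open B9Eq311L2Pairing (WL2)
open B4Sect5Torus (TSite tdist tdist_triangle tdist_nonneg tdist_symm torusSum_le)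
open B4Sect5Proof (latticeConst latticeConst_nonneg)
open B9Eq347LocalLetterAlgebra (local_comp_one)
open B9Eq347GlobalFromLocal (local_transport)
open B9Eq347LocalFromBlockDecay (local_of_block_decay)
open B9Eq349BlockDecayAlgebra (norm_block_comp3_le_of_decay)
open B9Eq349BlockMultipliers (sum_block_apply block_comp_self)

/-! ## §0 The local letter (L) through `WL2.equiv`: composition and weakening on the weighted carriers -/

section Algebra

variable {𝕜 : Type*} [RCLike 𝕜] {Y : Type*} [Fintype Y] (δ : Y → Y → ℝ)
  {X₁ X₂ X₃ : Type*} [Fintype X₁] [Fintype X₂] [Fintype X₃] [Nonempty X₁]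
  {w₁ : X₁ → ℝ} {w₂ : X₂ → ℝ} {w₃ : X₃ → ℝ} [Fact (∀ x, 0 < w₁ x)] [Fact (∀ x, 0 < w₂ x)] [Fact (∀ x, 0 < w₃ x)]
  {V₁ V₂ V₃ : Type*} [NormedAddCommGroup V₁] [InnerProductSpace 𝕜 V₁] [NormedAddCommGroup V₂] [InnerProductSpace 𝕜 V₂]
  [NormedAddCommGroup V₃] [InnerProductSpace 𝕜 V₃]
  (π₁ : X₁ → Y) (π₂ : X₂ → Y) (π₃ : X₃ → Y)

/-- **COMPOSITION OF TWO LOCAL LETTERS ON THE WEIGHTED CARRIERS** (`B9Eq347LocalLetterAlgebra.local_comp_one` transported through `WL2.linearEquiv` by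
`B9Eq347GlobalFromLocal.local_transport`): (L)(T₁; B₁, κ₁), (L)(T₂; B₂, κ₂), `0 ≤ κ′ ≤ κ₁`, `Σ_u e^{−(κ₂−κ′)δ(w,u)} ≤ S` ⟹ (L)(T₂∘T₁; B₁B₂S, κ′), every
letter read through `WL2.equiv`. [folklore] [cite: Balaban1985BackgroundPropagators, p.415 «random walk expansion», Thm 3.1 (3.42) p.397]
[cite: Balaban1984PropagatorsII, Lemma 2.1 (2.61) p.234] -/
theorem letter_comp (T₁ : WL2 𝕜 w₁ V₁ →L[𝕜] WL2 𝕜 w₂ V₂) (T₂ : WL2 𝕜 w₂ V₂ →L[𝕜] WL2 𝕜 w₃ V₃)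
    (hδ0 : ∀ u v, 0 ≤ δ u v) (hδt : ∀ u y v, δ u v ≤ δ u y + δ y v)
    {B₁ B₂ κ₁ κ₂ κ' S : ℝ} (hB₁ : 0 ≤ B₁) (hB₂ : 0 ≤ B₂) (hκ' : 0 ≤ κ') (hκ₁ : κ' ≤ κ₁)
    (h₁ : ∀ (v : Y) (f : WL2 𝕜 w₁ V₁) (F : ℝ), (∀ x, π₁ x ≠ v → WL2.equiv 𝕜 w₁ V₁ f x = 0) → (∀ x, ‖WL2.equiv 𝕜 w₁ V₁ f x‖ ≤ F) →
      ∀ x, ‖WL2.equiv 𝕜 w₂ V₂ (T₁ f) x‖ ≤ B₁ * Real.exp (-(κ₁ * δ (π₂ x) v)) * F)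
    (h₂ : ∀ (v : Y) (g : WL2 𝕜 w₂ V₂) (F : ℝ), (∀ x, π₂ x ≠ v → WL2.equiv 𝕜 w₂ V₂ g x = 0) → (∀ x, ‖WL2.equiv 𝕜 w₂ V₂ g x‖ ≤ F) →
      ∀ x, ‖WL2.equiv 𝕜 w₃ V₃ (T₂ g) x‖ ≤ B₂ * Real.exp (-(κ₂ * δ (π₃ x) v)) * F)
    (hS : ∀ w, ∑ u, Real.exp (-((κ₂ - κ') * δ w u)) ≤ S)
    (v : Y) (f : WL2 𝕜 w₁ V₁) (F : ℝ) (hfv : ∀ x, π₁ x ≠ v → WL2.equiv 𝕜 w₁ V₁ f x = 0) (hfF : ∀ x, ‖WL2.equiv 𝕜 w₁ V₁ f x‖ ≤ F)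
    (x : X₃) : ‖WL2.equiv 𝕜 w₃ V₃ ((T₂ ∘L T₁) f) x‖ ≤ B₁ * B₂ * S * Real.exp (-(κ' * δ (π₃ x) v)) * F := by
  have t₁ := local_transport π₁ (WL2.linearEquiv 𝕜 𝕜 w₁) (WL2.linearEquiv 𝕜 𝕜 w₂) (T₁ : WL2 𝕜 w₁ V₁ →ₗ[𝕜] WL2 𝕜 w₂ V₂)
    (rhs := fun x v F => B₁ * Real.exp (-(κ₁ * δ (π₂ x) v)) * F) (fun v f F hf hF x => h₁ v f F hf hF x)
  have t₂ := local_transport π₂ (WL2.linearEquiv 𝕜 𝕜 w₂) (WL2.linearEquiv 𝕜 𝕜 w₃) (T₂ : WL2 𝕜 w₂ V₂ →ₗ[𝕜] WL2 𝕜 w₃ V₃)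
    (rhs := fun x v F => B₂ * Real.exp (-(κ₂ * δ (π₃ x) v)) * F) (fun v f F hf hF x => h₂ v f F hf hF x)
  have h := local_comp_one π₁ π₂ π₃ δ _ _ hδ0 hδt hB₁ hB₂ hκ' hκ₁ t₁ t₂ hS v (WL2.equiv 𝕜 w₁ V₁ f) F hfv hfF x
  simpa using h

omit [Fintype Y] in
/-- **WEAKENING THE RATE AND THE CONSTANT** of a letter read through `WL2.equiv` (`δ ≥ 0`, `0 ≤ B ≤ B′`, `κ′ ≤ κ`). [folklore]
[cite: Balaban1985BackgroundPropagators, Thm 3.1 (3.42) p.397] -/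
theorem letter_mono (T : WL2 𝕜 w₁ V₁ →L[𝕜] WL2 𝕜 w₂ V₂) (hδ0 : ∀ u v, 0 ≤ δ u v) {B B' κ κ' : ℝ} (hB0 : 0 ≤ B) (hB : B ≤ B') (hκ : κ' ≤ κ)
    (h : ∀ (v : Y) (f : WL2 𝕜 w₁ V₁) (F : ℝ), (∀ x, π₁ x ≠ v → WL2.equiv 𝕜 w₁ V₁ f x = 0) → (∀ x, ‖WL2.equiv 𝕜 w₁ V₁ f x‖ ≤ F) →
      ∀ x, ‖WL2.equiv 𝕜 w₂ V₂ (T f) x‖ ≤ B * Real.exp (-(κ * δ (π₂ x) v)) * F)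
    (v : Y) (f : WL2 𝕜 w₁ V₁) (F : ℝ) (hfv : ∀ x, π₁ x ≠ v → WL2.equiv 𝕜 w₁ V₁ f x = 0) (hfF : ∀ x, ‖WL2.equiv 𝕜 w₁ V₁ f x‖ ≤ F)
    (x : X₂) : ‖WL2.equiv 𝕜 w₂ V₂ (T f) x‖ ≤ B' * Real.exp (-(κ' * δ (π₂ x) v)) * F := by
  obtain ⟨x₀⟩ := ‹Nonempty X₁›
  have hF : 0 ≤ F := (norm_nonneg _).trans (hfF x₀)
  refine (h v f F hfv hfF x).trans (mul_le_mul_of_nonneg_right ?_ hF)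
  refine mul_le_mul hB (Real.exp_le_exp.2 ?_) (Real.exp_nonneg _) (hB0.trans hB)
  nlinarith [hδ0 (π₂ x) v, mul_le_mul_of_nonneg_right hκ (hδ0 (π₂ x) v)]

omit [Fintype Y] in
/-- **CHANGING THE OUTPUT BLOCK MAP** at a bounded cost: if `δ(π₂x, v) ≤ δ(π₂′x, v) + r` for all outputs `x` and blocks `v` (e.g. a bond read at its base
point instead of its tip: neighbouring sites lie in blocks at `d_m`-distance `≤ 1`), then (L) with respect to `π₂′` at rate `κ ≥ 0` gives (L) with respect
to `π₂` with the constant multiplied by `e^{κr}` — the junction between a gradient row decaying from the bond's TIP block (storey J's `Π(b₊)`) and a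
consumer indexing bonds by their BASE point (`Π(b₋)`). [folklore] [cite: Balaban1985BackgroundPropagators, Thm 3.1 (3.42) p.397, (3.49) p.399] -/
theorem letter_reblock (T : WL2 𝕜 w₁ V₁ →L[𝕜] WL2 𝕜 w₂ V₂) (π₂' : X₂ → Y) {B κ r : ℝ} (hB : 0 ≤ B) (hκ : 0 ≤ κ)
    (hππ : ∀ x v, δ (π₂ x) v ≤ δ (π₂' x) v + r)
    (h : ∀ (v : Y) (f : WL2 𝕜 w₁ V₁) (F : ℝ), (∀ x, π₁ x ≠ v → WL2.equiv 𝕜 w₁ V₁ f x = 0) → (∀ x, ‖WL2.equiv 𝕜 w₁ V₁ f x‖ ≤ F) →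
      ∀ x, ‖WL2.equiv 𝕜 w₂ V₂ (T f) x‖ ≤ B * Real.exp (-(κ * δ (π₂' x) v)) * F)
    (v : Y) (f : WL2 𝕜 w₁ V₁) (F : ℝ) (hfv : ∀ x, π₁ x ≠ v → WL2.equiv 𝕜 w₁ V₁ f x = 0) (hfF : ∀ x, ‖WL2.equiv 𝕜 w₁ V₁ f x‖ ≤ F)
    (x : X₂) : ‖WL2.equiv 𝕜 w₂ V₂ (T f) x‖ ≤ B * Real.exp (κ * r) * Real.exp (-(κ * δ (π₂ x) v)) * F := by
  obtain ⟨x₀⟩ := ‹Nonempty X₁›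
  have hF : 0 ≤ F := (norm_nonneg _).trans (hfF x₀)
  refine (h v f F hfv hfF x).trans ?_
  have hexp : Real.exp (-(κ * δ (π₂' x) v)) ≤ Real.exp (κ * r) * Real.exp (-(κ * δ (π₂ x) v)) := by
    rw [← Real.exp_add]
    exact Real.exp_le_exp.2 (by nlinarith [hππ x v, mul_le_mul_of_nonneg_left (hππ x v) hκ])
  calc B * Real.exp (-(κ * δ (π₂' x) v)) * F ≤ B * (Real.exp (κ * r) * Real.exp (-(κ * δ (π₂ x) v))) * F :=
        mul_le_mul_of_nonneg_right (mul_le_mul_of_nonneg_left hexp hB) hF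
    _ = B * Real.exp (κ * r) * Real.exp (-(κ * δ (π₂ x) v)) * F := by ring

omit [Nonempty X₁] [Fintype Y] in
/-- **SUM OF TWO LETTERS** on the same carriers, read through `WL2.equiv`. [folklore] [cite: Balaban1985BackgroundPropagators, (3.153) p.426, Thm 3.1 (3.42) p.397] -/
theorem letter_add (T₁ T₂ : WL2 𝕜 w₁ V₁ →L[𝕜] WL2 𝕜 w₂ V₂) {B₁ B₂ κ : ℝ}
    (h₁ : ∀ (v : Y) (f : WL2 𝕜 w₁ V₁) (F : ℝ), (∀ x, π₁ x ≠ v → WL2.equiv 𝕜 w₁ V₁ f x = 0) → (∀ x, ‖WL2.equiv 𝕜 w₁ V₁ f x‖ ≤ F) →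
      ∀ x, ‖WL2.equiv 𝕜 w₂ V₂ (T₁ f) x‖ ≤ B₁ * Real.exp (-(κ * δ (π₂ x) v)) * F)
    (h₂ : ∀ (v : Y) (f : WL2 𝕜 w₁ V₁) (F : ℝ), (∀ x, π₁ x ≠ v → WL2.equiv 𝕜 w₁ V₁ f x = 0) → (∀ x, ‖WL2.equiv 𝕜 w₁ V₁ f x‖ ≤ F) →
      ∀ x, ‖WL2.equiv 𝕜 w₂ V₂ (T₂ f) x‖ ≤ B₂ * Real.exp (-(κ * δ (π₂ x) v)) * F)
    (v : Y) (f : WL2 𝕜 w₁ V₁) (F : ℝ) (hfv : ∀ x, π₁ x ≠ v → WL2.equiv 𝕜 w₁ V₁ f x = 0) (hfF : ∀ x, ‖WL2.equiv 𝕜 w₁ V₁ f x‖ ≤ F)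
    (x : X₂) : ‖WL2.equiv 𝕜 w₂ V₂ ((T₁ + T₂) f) x‖ ≤ (B₁ + B₂) * Real.exp (-(κ * δ (π₂ x) v)) * F := by
  rw [add_apply, WL2.equiv_add, Pi.add_apply]
  calc _ ≤ ‖WL2.equiv 𝕜 w₂ V₂ (T₁ f) x‖ + ‖WL2.equiv 𝕜 w₂ V₂ (T₂ f) x‖ := norm_add_le _ _
    _ ≤ B₁ * Real.exp (-(κ * δ (π₂ x) v)) * F + B₂ * Real.exp (-(κ * δ (π₂ x) v)) * F := add_le_add (h₁ v f F hfv hfF x) (h₂ v f F hfv hfF x)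
    _ = (B₁ + B₂) * Real.exp (-(κ * δ (π₂ x) v)) * F := by ring

end Algebra


/-! ## §1 The Woodbury assembly of the letter (L) of `G₁`: abstract carriers, every letter displayed -/

section Assembly

variable {𝕜 : Type*} [RCLike 𝕜] {XB Y : Type*} [Fintype XB] [Fintype Y] [DecidableEq Y] [Nonempty XB] [Nonempty Y]
  {wB : XB → ℝ} {wY : Y → ℝ} [Fact (∀ x, 0 < wB x)] [Fact (∀ y, 0 < wY y)]
  {V : Type*} [NormedAddCommGroup V] [InnerProductSpace 𝕜 V]
  (πB : XB → Y) (δ : Y → Y → ℝ) (hδ0 : ∀ u v, 0 ≤ δ u v) (hδt : ∀ u y v, δ u v ≤ δ u y + δ y v) (hδs : ∀ u v, δ u v = δ v u)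
  {P : Y → WL2 𝕜 wB V →L[𝕜] WL2 𝕜 wB V}
  (hP : ∀ (y : Y) (f : WL2 𝕜 wB V) (x : XB), WL2.equiv 𝕜 wB V (P y f) x = if πB x = y then WL2.equiv 𝕜 wB V f x else 0)
  {rY : Y → WL2 𝕜 wY V →L[𝕜] WL2 𝕜 wY V}
  (hrY : ∀ (y : Y) (g : WL2 𝕜 wY V) (u : Y), WL2.equiv 𝕜 wY V (rY y g) u = if u = y then WL2.equiv 𝕜 wY V g u else 0)
  (A G : WL2 𝕜 wB V →L[𝕜] WL2 𝕜 wB V) (Uop : WL2 𝕜 wY V →L[𝕜] WL2 𝕜 wB V) (Vop : WL2 𝕜 wB V →L[𝕜] WL2 𝕜 wY V)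
  (C : WL2 𝕜 wY V →L[𝕜] WL2 𝕜 wY V)

omit [Nonempty XB] [Nonempty Y] in
include hδ0 hδt hδs hP in
/-- **THE CORE `V∘G₁∘Uu` ON THE UNIT LATTICE — ENTRIES FROM THREE BLOCK LETTERS** (`B9Eq349BlockDecayAlgebra.norm_block_comp3_le_of_decay` through the bond
block family `P`): `‖r_{y₁}∘V∘P_z‖ ≤ C_V e^{−κδ(z,y₁)}`, `‖P_{z′}∘G₁∘P_z‖ ≤ A₁e^{−κδ(z,z′)}`, `‖P_z∘Uu∘r_{y₀}‖ ≤ C_U e^{−κδ(y₀,z)}`, `0 ≤ κ″ ≤ κ`, the row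
constant `Σ_z e^{−(κ−κ″)δ(y,z)} ≤ S` ⟹ `‖r_{y₁}∘(V∘G₁∘Uu)∘r_{y₀}‖ ≤ C_V·A₁·C_U·S²·e^{−κ″δ(y₀,y₁)}`. [folklore]
[cite: Balaban1985BackgroundPropagators, (3.25)–(3.26) pp.394–395, (3.49) p.399, p.415 «random walk expansion»] -/
theorem core_point_decay {CV A₁ CU κ κ'' S : ℝ} (hCV : 0 ≤ CV) (hA₁ : 0 ≤ A₁) (hCU : 0 ≤ CU) (hκ'' : 0 ≤ κ'') (hκ : κ'' ≤ κ)
    (hVblk : ∀ z y, ‖rY y ∘L Vop ∘L P z‖ ≤ CV * Real.exp (-(κ * δ z y)))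
    (hGblk : ∀ z z', ‖P z' ∘L G ∘L P z‖ ≤ A₁ * Real.exp (-(κ * δ z z')))
    (hUblk : ∀ y z, ‖P z ∘L Uop ∘L rY y‖ ≤ CU * Real.exp (-(κ * δ y z)))
    (hS : ∀ y, ∑ z, Real.exp (-((κ - κ'') * δ y z)) ≤ S) (y₀ y₁ : Y) :
    ‖rY y₁ ∘L (Vop ∘L G ∘L Uop) ∘L rY y₀‖ ≤ CV * A₁ * CU * S ^ 2 * Real.exp (-(κ'' * δ y₀ y₁)) :=
  norm_block_comp3_le_of_decay hδ0 (fun u y w => hδt u y w) hδs P (sum_block_apply hP) (block_comp_self hP) P (sum_block_apply hP)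
    (block_comp_self hP) Vop G Uop rY rY hCV hA₁ hCU hκ'' hκ hVblk hGblk hUblk hS y₀ y₁

omit [Nonempty XB] in
include hδs hrY in
/-- **THE CORE's LOCAL LETTER** (blocks = points on the unit lattice: `B9Eq347LocalFromBlockDecay.local_of_block_decay` at `π = id`, price `√μ_Y∕√ω_Y`,
`= 1` for a constant coarse weight): point decay `(B_X, κ″)` of `X = V∘G₁∘Uu` ⟹ (L)(X; B_X·√μ_Y∕√ω_Y, κ″). [folklore]
[cite: Balaban1985BackgroundPropagators, Thm 3.1 (3.42) p.397, (3.49) p.399] -/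
theorem core_letter_of_point_decay (X : WL2 𝕜 wY V →L[𝕜] WL2 𝕜 wY V) {BX κ'' ωY μY : ℝ} (hBX : 0 ≤ BX) (hωY : 0 < ωY)
    (hwY : ∀ y, ωY ≤ wY y) (hwYμ : ∀ y, wY y ≤ μY)
    (hX : ∀ y₀ y₁, ‖rY y₁ ∘L X ∘L rY y₀‖ ≤ BX * Real.exp (-(κ'' * δ y₀ y₁)))
    (v : Y) (g : WL2 𝕜 wY V) (F : ℝ) (hgv : ∀ u, id u ≠ v → WL2.equiv 𝕜 wY V g u = 0) (hgF : ∀ u, ‖WL2.equiv 𝕜 wY V g u‖ ≤ F) (u : Y) :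
    ‖WL2.equiv 𝕜 wY V (X g) u‖ ≤ BX * Real.sqrt μY / Real.sqrt ωY * Real.exp (-(κ'' * δ (id u) v)) * F := by
  have hμ : ∀ v : Y, ∑ y, (if id y = v then wY y else 0) ≤ μY := fun v => by
    show ∑ y, (if y = v then wY y else 0) ≤ μY
    rw [Finset.sum_ite_eq' Finset.univ v wY, if_pos (Finset.mem_univ _)]
    exact hwYμ v
  exact local_of_block_decay (π := id) (π' := id) hrY hrY X δ hBX hωY hwY hμ (fun u v => by rw [hδs]; exact hX v u) v g F hgv hgF u

include hδ0 hδt hδs hP hrY in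
/-- **THE LETTER (L) OF `G₁` FROM THE WOODBURY IDENTITY AND THE DISPLAYED LETTERS** (abstract carriers: fine bonds `X_B` with weights `w_B` and
block map `π_B`, the unit lattice `Y` with weights `w_Y ∈ [ω_Y, μ_Y]`, any pseudo-metric `δ`; bond block family `P`, point family `r` by their
(K1) letters).  HYPOTHESES: the identity `hW : G₁f = A₀⁻¹f + A₀⁻¹(Uu((c + c∘V∘G₁∘Uu∘c)(V(A₀⁻¹f))))` for every `f` (print's (3.26) around its local part —
`B9Eq326WoodburySchur.G1ofU_eq_woodbury` ∕ its tower twin `G1k_eq_woodbury` read pointwise); the letters (L)(A₀⁻¹; B_A, κ) (bonds → bonds), (L)(Uu; B_U, κ) (points → bonds),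
(L)(V∘A₀⁻¹; B_V, κ′) (bonds → points, at the TARGET rate — it is the innermost factor), (L)(c; B_c, κ) (points → points); the block letters
`‖P_{z′}∘G₁∘P_z‖ ≤ A₁e^{−κδ}`, `‖P_z∘Uu∘r_y‖ ≤ C_Ue^{−κδ}`, `‖r_y∘V∘P_z‖ ≤ C_Ve^{−κδ}`; `0 ≤ κ′ < κ` and ONE row constant `Σ_u e^{−((κ−κ′)∕2)δ(w,u)} ≤ S`.
CONCLUSION: (L)(G₁; B⋆, κ′) with **`B⋆ = B_A + B_A·B_U·B_c·B_V·S³·(1 + B_c·(C_V·A₁·C_U·S²·√μ_Y∕√ω_Y)·S²)`** — for every block `v`, every bond field `f`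
supported over `π_B⁻¹(v)` with `‖f(b)‖ ≤ F`, every bond `b`: `‖(G₁f)(b)‖ ≤ B⋆·e^{−κ′δ(π_B b, v)}·F`.  Proof: the two words `A₀⁻¹∘Uu∘c∘(V∘A₀⁻¹)` and
`A₀⁻¹∘Uu∘c∘X∘c∘(V∘A₀⁻¹)`, `X = V∘G₁∘Uu`, by `letter_comp` with the OUTER factor always at rate `κ` (no further rate loss), `X` entering through
`core_point_decay` at the middle rate `(κ+κ′)∕2` and `core_letter_of_point_decay`; then `letter_add`. [folklore]
[cite: Balaban1985BackgroundPropagators, (3.25)–(3.26) pp.394–395, Thm 3.1 (3.42) p.397, (3.49) p.399, Thm 3.11 p.416, p.415] -/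
theorem local_letter_G1_of_letters
    (hW : ∀ f, G f = A f + A (Uop ((C + C ∘L Vop ∘L G ∘L Uop ∘L C) (Vop (A f)))))
    {BA BU BV Bc A₁ CU CV κ κ' S ωY μY : ℝ} (hBA : 0 ≤ BA) (hBU : 0 ≤ BU) (hBV : 0 ≤ BV) (hBc : 0 ≤ Bc) (hA₁ : 0 ≤ A₁) (hCU : 0 ≤ CU)
    (hCV : 0 ≤ CV) (hκ' : 0 ≤ κ') (hκ : κ' < κ) (hωY : 0 < ωY) (hwY : ∀ y, ωY ≤ wY y) (hwYμ : ∀ y, wY y ≤ μY)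
    (hA : ∀ (v : Y) (f : WL2 𝕜 wB V) (F : ℝ), (∀ x, πB x ≠ v → WL2.equiv 𝕜 wB V f x = 0) → (∀ x, ‖WL2.equiv 𝕜 wB V f x‖ ≤ F) →
      ∀ x, ‖WL2.equiv 𝕜 wB V (A f) x‖ ≤ BA * Real.exp (-(κ * δ (πB x) v)) * F)
    (hU : ∀ (v : Y) (g : WL2 𝕜 wY V) (F : ℝ), (∀ u, id u ≠ v → WL2.equiv 𝕜 wY V g u = 0) → (∀ u, ‖WL2.equiv 𝕜 wY V g u‖ ≤ F) →
      ∀ x, ‖WL2.equiv 𝕜 wB V (Uop g) x‖ ≤ BU * Real.exp (-(κ * δ (πB x) v)) * F)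
    (hVA : ∀ (v : Y) (f : WL2 𝕜 wB V) (F : ℝ), (∀ x, πB x ≠ v → WL2.equiv 𝕜 wB V f x = 0) → (∀ x, ‖WL2.equiv 𝕜 wB V f x‖ ≤ F) →
      ∀ u, ‖WL2.equiv 𝕜 wY V ((Vop ∘L A) f) u‖ ≤ BV * Real.exp (-(κ' * δ (id u) v)) * F)
    (hC : ∀ (v : Y) (g : WL2 𝕜 wY V) (F : ℝ), (∀ u, id u ≠ v → WL2.equiv 𝕜 wY V g u = 0) → (∀ u, ‖WL2.equiv 𝕜 wY V g u‖ ≤ F) →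
      ∀ u, ‖WL2.equiv 𝕜 wY V (C g) u‖ ≤ Bc * Real.exp (-(κ * δ (id u) v)) * F)
    (hGblk : ∀ z z', ‖P z' ∘L G ∘L P z‖ ≤ A₁ * Real.exp (-(κ * δ z z')))
    (hUblk : ∀ y z, ‖P z ∘L Uop ∘L rY y‖ ≤ CU * Real.exp (-(κ * δ y z)))
    (hVblk : ∀ z y, ‖rY y ∘L Vop ∘L P z‖ ≤ CV * Real.exp (-(κ * δ z y)))
    (hS : ∀ w, ∑ u, Real.exp (-((κ - κ') / 2 * δ w u)) ≤ S)
    (v : Y) (f : WL2 𝕜 wB V) (F : ℝ) (hfv : ∀ x, πB x ≠ v → WL2.equiv 𝕜 wB V f x = 0) (hfF : ∀ x, ‖WL2.equiv 𝕜 wB V f x‖ ≤ F)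
    (b : XB) :
    ‖WL2.equiv 𝕜 wB V (G f) b‖ ≤
      (BA + BA * BU * Bc * BV * S ^ 3 * (1 + Bc * (CV * A₁ * CU * S ^ 2 * (Real.sqrt μY / Real.sqrt ωY)) * S ^ 2)) *
        Real.exp (-(κ' * δ (πB b) v)) * F := by
  obtain ⟨x₀⟩ := ‹Nonempty XB›
  have hF : 0 ≤ F := (norm_nonneg _).trans (hfF x₀)
  have hS0 : 0 ≤ S := (Finset.sum_nonneg fun u _ => Real.exp_nonneg _).trans (hS v)
  -- the two gaps: `κ − κ′` (outer factors at rate `κ`) and `(κ − κ′)/2` (the core at the middle rate)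
  have hgap : 0 < (κ - κ') / 2 := by linarith
  have hS' : ∀ w, ∑ u, Real.exp (-((κ - κ') * δ w u)) ≤ S := fun w =>
    (Finset.sum_le_sum fun u _ => Real.exp_le_exp.2 (by nlinarith [hδ0 w u])).trans (hS w)
  have hSm : ∀ w, ∑ u, Real.exp (-((κ - (κ + κ') / 2) * δ w u)) ≤ S := fun w => by
    have e : κ - (κ + κ') / 2 = (κ - κ') / 2 := by ring
    rw [e]; exact hS w
  have hSm' : ∀ w, ∑ u, Real.exp (-(((κ + κ') / 2 - κ') * δ w u)) ≤ S := fun w => by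
    have e : (κ + κ') / 2 - κ' = (κ - κ') / 2 := by ring
    rw [e]; exact hS w
  have hκm : κ' ≤ (κ + κ') / 2 := by linarith
  have hκm' : (κ + κ') / 2 ≤ κ := by linarith
  have hκm0 : 0 ≤ (κ + κ') / 2 := by linarith
  -- (a) `T_a = c ∘ (V∘A₀⁻¹)` : bonds → points, `(B_V·B_c·S, κ′)`
  have ha := letter_comp δ πB id id (Vop ∘L A) C hδ0 hδt hBV hBc hκ' le_rfl hVA hC hS'
  -- (b) the core `X = V∘G₁∘Uu` at the middle rate
  have hXblk := core_point_decay πB δ hδ0 hδt hδs hP (rY := rY) G Uop Vop hCV hA₁ hCU hκm0 hκm' hVblk hGblk hUblk hSm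
  have hBX : 0 ≤ CV * A₁ * CU * S ^ 2 := by positivity
  have hX := core_letter_of_point_decay δ hδs hrY (Vop ∘L G ∘L Uop) hBX hωY hwY hwYμ hXblk
  have hBX' : 0 ≤ CV * A₁ * CU * S ^ 2 * Real.sqrt μY / Real.sqrt ωY := by positivity
  -- (c) `T_b = X ∘ T_a` : bonds → points, outer at the middle rate, target `κ′`
  have hb := letter_comp δ πB id id (C ∘L (Vop ∘L A)) (Vop ∘L G ∘L Uop) hδ0 hδt (by positivity) hBX' hκ' le_rfl ha
    (fun v g F hg hF u => by
      have := hX v g F hg hF u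
      calc _ ≤ CV * A₁ * CU * S ^ 2 * Real.sqrt μY / Real.sqrt ωY * Real.exp (-((κ + κ') / 2 * δ (id u) v)) * F := this
        _ = _ := by ring) hSm'
  -- (d) `T_c = c ∘ T_b`
  have hc := letter_comp δ πB id id ((Vop ∘L G ∘L Uop) ∘L (C ∘L (Vop ∘L A))) C hδ0 hδt (by positivity) hBc hκ' le_rfl hb hC hS'
  -- (e) `Uu ∘ T_a`, `Uu ∘ T_c` : bonds → bonds
  have hUa := letter_comp δ πB id πB (C ∘L (Vop ∘L A)) Uop hδ0 hδt (by positivity) hBU hκ' le_rfl ha hU hS'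
  have hUc := letter_comp δ πB id πB (C ∘L ((Vop ∘L G ∘L Uop) ∘L (C ∘L (Vop ∘L A)))) Uop hδ0 hδt (by positivity) hBU hκ' le_rfl hc hU hS'
  -- (f) `A₀⁻¹ ∘ Uu ∘ T_a`, `A₀⁻¹ ∘ Uu ∘ T_c`
  have hW₁ := letter_comp δ πB πB πB (Uop ∘L (C ∘L (Vop ∘L A))) A hδ0 hδt (by positivity) hBA hκ' le_rfl hUa hA hS' v f F hfv hfF b
  have hW₂ := letter_comp δ πB πB πB (Uop ∘L (C ∘L ((Vop ∘L G ∘L Uop) ∘L (C ∘L (Vop ∘L A))))) A hδ0 hδt (by positivity) hBA hκ' le_rfl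
    hUc hA hS' v f F hfv hfF b
  -- (g) `A₀⁻¹` itself, weakened to the target rate
  have hA' := letter_mono δ πB πB A hδ0 hBA le_rfl hκ.le hA v f F hfv hfF b
  -- (h) the identity, applied to `f` and read at `b`
  have e : G f = A f + (A ∘L (Uop ∘L (C ∘L (Vop ∘L A)))) f + (A ∘L (Uop ∘L (C ∘L ((Vop ∘L G ∘L Uop) ∘L (C ∘L (Vop ∘L A)))))) f := by
    rw [hW f]
    simp only [add_apply, ContinuousLinearMap.comp_apply, map_add]
    abel
  rw [e, WL2.equiv_add, WL2.equiv_add, Pi.add_apply, Pi.add_apply]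
  have hsum := add_le_add (add_le_add hA' hW₁) hW₂
  refine ((norm_add_le _ _).trans (add_le_add (norm_add_le _ _) le_rfl)).trans (hsum.trans (le_of_eq ?_))
  ring

omit [DecidableEq Y] [Nonempty Y] in
include hδ0 hδt in
/-- **THE FOUR-LETTER FORM** (the Schur core `S⁻¹` DISPLAYED as one operator `Sc` with its own letter — the interface of ne9-leaf-03 g78's (AWS)
`B9Eq326WoodburySupRowAssembly.woodbury_sup_row`, here on the weighted carriers): `hW₄ : G₁f = A₀⁻¹f + A₀⁻¹(Uu(Sc((V∘A₀⁻¹)f)))`, (L)(A₀⁻¹; B_A, κ),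
(L)(Uu; B_U, κ), (L)(V∘A₀⁻¹; B_V, κ′), (L)(Sc; B_S, κ_S), `0 ≤ κ′ ≤ κ`, two row constants `Σ_u e^{−(κ−κ′)δ(w,u)} ≤ S₁`, `Σ_u e^{−(κ_S−κ′)δ(w,u)} ≤ S₂` ⟹
**(L)(G₁; B_A + B_V·B_S·S₂·B_U·S₁·B_A·S₁, κ′)** (three `letter_comp`, outer factors `Sc`, `Uu`, `A₀⁻¹`). [folklore]
[cite: Balaban1985BackgroundPropagators, (3.25)–(3.26) pp.394–395, Thm 3.1 (3.42) p.397, Thm 3.3 p.399] -/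
theorem local_letter_G1_of_four_letters (Sc : WL2 𝕜 wY V →L[𝕜] WL2 𝕜 wY V)
    (hW₄ : ∀ f, G f = A f + A (Uop (Sc ((Vop ∘L A) f))))
    {BA BU BV BS κ κS κ' S₁ S₂ : ℝ} (hBA : 0 ≤ BA) (hBU : 0 ≤ BU) (hBV : 0 ≤ BV) (hBS : 0 ≤ BS) (hκ' : 0 ≤ κ') (hκ : κ' ≤ κ)
    (hA : ∀ (v : Y) (f : WL2 𝕜 wB V) (F : ℝ), (∀ x, πB x ≠ v → WL2.equiv 𝕜 wB V f x = 0) → (∀ x, ‖WL2.equiv 𝕜 wB V f x‖ ≤ F) →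
      ∀ x, ‖WL2.equiv 𝕜 wB V (A f) x‖ ≤ BA * Real.exp (-(κ * δ (πB x) v)) * F)
    (hU : ∀ (v : Y) (g : WL2 𝕜 wY V) (F : ℝ), (∀ u, id u ≠ v → WL2.equiv 𝕜 wY V g u = 0) → (∀ u, ‖WL2.equiv 𝕜 wY V g u‖ ≤ F) →
      ∀ x, ‖WL2.equiv 𝕜 wB V (Uop g) x‖ ≤ BU * Real.exp (-(κ * δ (πB x) v)) * F)
    (hVA : ∀ (v : Y) (f : WL2 𝕜 wB V) (F : ℝ), (∀ x, πB x ≠ v → WL2.equiv 𝕜 wB V f x = 0) → (∀ x, ‖WL2.equiv 𝕜 wB V f x‖ ≤ F) →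
      ∀ u, ‖WL2.equiv 𝕜 wY V ((Vop ∘L A) f) u‖ ≤ BV * Real.exp (-(κ' * δ (id u) v)) * F)
    (hSc : ∀ (v : Y) (g : WL2 𝕜 wY V) (F : ℝ), (∀ u, id u ≠ v → WL2.equiv 𝕜 wY V g u = 0) → (∀ u, ‖WL2.equiv 𝕜 wY V g u‖ ≤ F) →
      ∀ u, ‖WL2.equiv 𝕜 wY V (Sc g) u‖ ≤ BS * Real.exp (-(κS * δ (id u) v)) * F)
    (hS₁ : ∀ w, ∑ u, Real.exp (-((κ - κ') * δ w u)) ≤ S₁) (hS₂ : ∀ w, ∑ u, Real.exp (-((κS - κ') * δ w u)) ≤ S₂)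
    (v : Y) (f : WL2 𝕜 wB V) (F : ℝ) (hfv : ∀ x, πB x ≠ v → WL2.equiv 𝕜 wB V f x = 0) (hfF : ∀ x, ‖WL2.equiv 𝕜 wB V f x‖ ≤ F)
    (b : XB) :
    ‖WL2.equiv 𝕜 wB V (G f) b‖ ≤ (BA + BV * BS * S₂ * BU * S₁ * BA * S₁) * Real.exp (-(κ' * δ (πB b) v)) * F := by
  have hS₁0 : 0 ≤ S₁ := (Finset.sum_nonneg fun u _ => Real.exp_nonneg _).trans (hS₁ v)
  have hS₂0 : 0 ≤ S₂ := (Finset.sum_nonneg fun u _ => Real.exp_nonneg _).trans (hS₂ v)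
  have ha := letter_comp δ πB id id (Vop ∘L A) Sc hδ0 hδt hBV hBS hκ' le_rfl hVA hSc hS₂
  have hUa := letter_comp δ πB id πB (Sc ∘L (Vop ∘L A)) Uop hδ0 hδt (by positivity) hBU hκ' le_rfl ha hU hS₁
  have hW₁ := letter_comp δ πB πB πB (Uop ∘L (Sc ∘L (Vop ∘L A))) A hδ0 hδt (by positivity) hBA hκ' le_rfl hUa hA hS₁ v f F hfv hfF b
  have hA' := letter_mono δ πB πB A hδ0 hBA le_rfl hκ hA v f F hfv hfF b
  have e : G f = A f + (A ∘L (Uop ∘L (Sc ∘L (Vop ∘L A)))) f := by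
    rw [hW₄ f]
    simp only [ContinuousLinearMap.comp_apply]
  rw [e, WL2.equiv_add, Pi.add_apply]
  refine (norm_add_le _ _).trans ((add_le_add hA' hW₁).trans (le_of_eq ?_))
  ring

end Assembly

end Literature.MathematicalPhysics.QuantumFieldTheory.Balaban1983to89.B9Eq326G1SupRowOfLetters

end
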